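import Mathlib
import HarnessLib
import Summits.HubbardSuperconductivity.HubbardSuperconductivity.Theorems.KLProgrammeKLRegimeEngineScaleZeroKernelNormsWt
import Summits.HubbardSuperconductivity.HubbardSuperconductivity.Theorems.KLProgrammeKLRegimeEngineTowerWtFullInputs

/-!
# Route `KLProgramme` — crux K3 ENGINE (stmt-HubbardSuperconductivity-20437 `KLRegimeEngineV17F2`), stub (b) v2, THE LEVELS PACKAGE (ℓ), (I3) at BLOCK 0:
# THE TRIVIAL-FAMILY UV DATUM `klTowerUVWt / klTowerUVLev` OF `𝒱_0` FROM p3 g8's ONE WEIGHTED GRID STEP, READ THROUGH THE TRIVIAL ANALYSIS `E_t·S`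
# («(ℓ)-BLOCK0-UV», located «(ℓ)-BLOCK0-SOURCE»; cell gate-hubbard-kl, seat hubbard-kl-k3c2-p3 g13; KL STATUS 2026-08-28 ≈20:55Z)

The levelled law `klTowerBLev_le_law_of_inputs_uv` (…TowerLevLawOfInputsUV, p4 g18) reads block `0` through the named array
`μ0 m = W₀·Z₀^m·klTowerUVLev … (2m)/ε^{2m−1}` (…TowerLevStepLinkZero / …TowerLevStepLinkUniform), i.e. through the TRIVIAL-family `L¹–L^∞` norms of the
scale-`0` action `𝒱_0 = klEffectiveAction … klE0 0`.  The scale-`0` packages `KernelNormsV4 / KernelNormsLevels … K 0` are `F_0`-sectorised and cannot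
see legs of `𝒱_0` away from the plateau of `F_0`; the trivial-family norms are produced here DIRECTLY from p3 g8's single weighted determinant-bounded
grid step (…ScaleZeroKernelNormsWt: `𝒱_0 = effAction C^K_{>e₀} (S·(V_N + 𝒩_{K,N}))`, `S = hubbardGridSub … (4M)`) read through the trivial analysis
`E_t·S`, `E_t = sectorAnalysisMatrix β (trivialMultiplier L M)`, in place of `E₀·S` — the Literature steps
`sum_wt_norm_kernel_map_effAction_le_biquartic_of_gramBounded` / `sum_filter_wt_norm_kernel_map_le_of_pos` take the analysis map as a parameter.
Hypotheses = p3 g8's three weighted sizes VERBATIM (Gram `κ` of `SᵀC^K_{>e₀}S`, its `gridLabelWt`-pair-weighted row/column sums `α_w`, the smallness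
`θ_w = e·α_w·‖Ṽ‖_{h,wt}/κ² < 1`, weight `ρ > 0`) + the cross sums `cr_t / cc_t` of `E_t·S` (NEW named inputs; `E_t·S` is the grid embedding read on the
`2M`-lattice).

* §2 `uvWtPinnedSum_le_of_wgridStep` — degrees `2p ≥ 4`: every trivial-family `gridLabelWt`-weighted one-pinned sum of `𝒱_0` is
  `≤ cr_t·cc_t^{2p−1}·(ρ^{−2p}·e f₂·(eα_w f₂/κ²)^{p−2}/(1−θ_w)^p)`, `f₂ = (e²(κ+ρ))⁴·|U||β|/(4M)` (BI-GRADED: `|U|^{p−1}`);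
  `uvWtPinnedSum_le_of_wgridStep_full` — every degree `m ≥ 1`: `≤ cr_t·cc_t^{m−1}·(ρ^{−m}·e‖Ṽ‖_{h,wt}/(1−θ_w))`;
* §1 `klTowerUVWt_le_of_pinned`, `klTowerUVLev_le_of_pinned` (the two UV carriers are dominated by any common bound of the `gridLabelWt`-weighted one-pinned sums:
  `klScaleWt_0 ≤ gridLabelWt`, `1 ≤ gridLabelWt`); §3 **`klTowerUVWt_le_of_wgridStep`**, **`klTowerUVLev_le_of_wgridStep`** (degrees `2p ≥ 4`),
  **`klTowerUVLev_le_of_wgridStep_full`** (every degree `m ≥ 1`; used at `m = 2` for the law's `μ0 1`);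
* §4 `uvBracket_eq_profile` (the bi-graded bracket as `A₀·P₀^p`, `A₀ = cr_t·e f₂/(cc_t·G²)`, `P₀ = cc_t²ρ⁻²G/(1−θ_w)`, `G = eα_w f₂/κ²`) and
  **`towerUVArray_le_profile`** — the law's `μ0 m = W₀Z₀^m·klTowerUVLev(2m)/ε^{2m−1}` obeys `μ0 m ≤ A′λ^{m−1}Q′^m` for `m ≥ 2` with `A′ := W₀A₀λ`, `Q′ := Z₀P₀/λ`
  (the `ε^{2m−1}` of §3 cancels the unit) — the `hμ0prof`/`hμ03`/`hι₂ (k = 0)` shape of the law (E1 (I5) takes the `max` with the `k ≥ 1` constants).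
Compositions of landed theorems and real algebra; nothing about the model is asserted beyond them; nothing asserts (ℓ), any stub, K3 or superconductivity.
References: BGM 2006 (2.13)–(2.14), (2.77)–(2.84), §3 (3.2)–(3.8) [cite: BenfattoGiulianiMastropietro2006]; Pedra–Salmhofer 2008 Thm 2.4 [cite: PedraSalmhofer2008].
-/

noncomputable section

namespace Summit.HubbardSuperconductivity.HubbardSuperconductivity.Theorems.EngineV8

set_option linter.dupNamespace false -- summit = problem name (single-conjunct summit), D-0017

open Real Finset Literature.MathematicalPhysics.QuantumLattice Literature.Probability.LatticeModels
open Literature.Probability.LatticeModels.BattleFederbush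
open Literature.MathematicalPhysics.QuantumLattice.GrassmannAlgebra
open Summit.HubbardSuperconductivity.HubbardSuperconductivity.Theorems.KLRegimeSplit
open Summit.HubbardSuperconductivity.HubbardSuperconductivity.Theorems.DispersionFlow
open Summit.HubbardSuperconductivity.HubbardSuperconductivity.Theorems.KLProgrammeLegKernels

variable {L M : ℕ} [NeZero L]

/-! ## §1 The UV carriers `klTowerUVWt`, `klTowerUVLev` from any bound on the weighted one-pinned sums -/

/-- **`klTowerUVWt … m` is dominated by any common bound of the `gridLabelWt`-weighted one-pinned sums** (`klScaleWt_0 ≤ gridLabelWt`, `0 ≤ B`, `β ≥ 0`). -/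
theorem klTowerUVWt_le_of_pinned [NeZero M] {β : ℝ} (hβ : 0 ≤ β) (U μ : ℝ) (K : TrigPolyC4v) {m : ℕ} {B : ℝ} (hB : 0 ≤ B)
    (h : ∀ (q : Fin m) (w : SpaceTimeIdx L M × SectorLeg 1),
      ∑ X ∈ univ.filter (fun X : Fin m → SpaceTimeIdx L M × SectorLeg 1 => X q = w),
        gridLabelWt L (2 * (2 * M)) β ((univ.image X).image (latticeLegPos (2 * (2 * M)))) *
          ‖kernel ℂ (ExteriorAlgebra.map (Matrix.toLin' (sectorAnalysisMatrix L M β (trivialMultiplier L M)))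
              (klEffectiveAction L M β U μ K klE0 0)) m X‖ ≤ B) :
    klTowerUVWt L M β U μ K m ≤ imagTimeWeight β M ^ (m - 1) * B := by
  have hε : 0 ≤ imagTimeWeight β M := imagTimeWeight_nonneg hβ M
  unfold klTowerUVWt
  refine Real.iSup_le (fun qw => ?_) (by positivity)
  refine mul_le_mul_of_nonneg_left ?_ (pow_nonneg hε _)
  refine le_trans (sum_le_sum fun X _ => ?_) (h qw.1 qw.2)
  exact mul_le_mul_of_nonneg_right (klScaleWt_zero_le_gridLabelWt β _) (norm_nonneg _)

/-- **`klTowerUVLev … m` is dominated by any common bound of the `gridLabelWt`-weighted one-pinned sums** (`1 ≤ gridLabelWt`; the trivial-family sectorised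
kernel is the kernel of `map E_t 𝒱_0`, `kernel_map_sectorAnalysis`; `0 ≤ B`, `β ≥ 0`). -/
theorem klTowerUVLev_le_of_pinned [NeZero M] {β : ℝ} (hβ : 0 ≤ β) (U μ : ℝ) (K : TrigPolyC4v) {m : ℕ} (hm : 1 ≤ m) {B : ℝ} (hB : 0 ≤ B)
    (h : ∀ (q : Fin m) (w : SpaceTimeIdx L M × SectorLeg 1),
      ∑ X ∈ univ.filter (fun X : Fin m → SpaceTimeIdx L M × SectorLeg 1 => X q = w),
        gridLabelWt L (2 * (2 * M)) β ((univ.image X).image (latticeLegPos (2 * (2 * M)))) *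
          ‖kernel ℂ (ExteriorAlgebra.map (Matrix.toLin' (sectorAnalysisMatrix L M β (trivialMultiplier L M)))
              (klEffectiveAction L M β U μ K klE0 0)) m X‖ ≤ B) :
    klTowerUVLev L M β U μ K m ≤ imagTimeWeight β M ^ (m - 1) * B := by
  have hε : 0 ≤ imagTimeWeight β M := imagTimeWeight_nonneg hβ M
  obtain ⟨n, rfl⟩ : ∃ n, m = n + 1 := ⟨m - 1, by omega⟩
  rw [Nat.add_sub_cancel, klTowerUVLev, hubbardSectorKernelNorm_def]
  refine sectorisedKernelNorm_le_of_forall_le (by positivity) fun p s y => ?_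
  rw [sectorLegSum_def, ← mul_sum]
  refine mul_le_mul_of_nonneg_left ?_ (pow_nonneg hε n)
  -- relabel the label-then-position double sum as the one-pinned sum over `X : Fin (n+1) → SpaceTimeIdx × SectorLeg 1`
  have hR : ∑ X ∈ univ.filter (fun X : Fin (n + 1) → SpaceTimeIdx L M × SectorLeg 1 => X p = (y, s)),
        ‖kernel ℂ (ExteriorAlgebra.map (Matrix.toLin' (sectorAnalysisMatrix L M β (trivialMultiplier L M)))
            (klEffectiveAction L M β U μ K klE0 0)) (n + 1) X‖ =
      ∑ σ ∈ univ.filter (fun σ : Fin (n + 1) → SectorLeg 1 => σ p = s),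
        ∑ x ∈ univ.filter (fun x : Fin (n + 1) → SpaceTimeIdx L M => x p = y),
          ‖sectorisedKernel L M β (trivialMultiplier L M) (klEffectiveAction L M β U μ K klE0 0) (n + 1) σ x‖ := by
    rw [← sum_pinned_prod_eq (fun x σ => ‖sectorisedKernel L M β (trivialMultiplier L M) (klEffectiveAction L M β U μ K klE0 0) (n + 1) σ x‖) p y s]
    refine sum_congr rfl fun Y _ => ?_
    rw [kernel_map_sectorAnalysis]
  rw [← hR]
  refine le_trans (sum_le_sum fun X _ => ?_) (h p (y, s))
  exact le_mul_of_one_le_left (norm_nonneg _) (one_le_gridLabelWt L _ β _)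

section GridStep

variable [NeZero M] {β : ℝ} (hβ : 0 < β) (U μ : ℝ) (K : TrigPolyC4v)
  {κ : ℝ} (hκ : 0 < κ)
    (hGB : IsGramBoundedR ((hubbardGridSub L M β (2 * (2 * M))).transpose * hubbardCovAboveCT L M β μ 0 K klE0 *
      hubbardGridSub L M β (2 * (2 * M))) κ)
    {αw : ℝ} (hαw : 0 < αw)
    (hrow : ∀ X, ∑ Y, ‖((hubbardGridSub L M β (2 * (2 * M))).transpose * hubbardCovAboveCT L M β μ 0 K klE0 *
      hubbardGridSub L M β (2 * (2 * M))) X Y‖ * gridLabelWt L (2 * (2 * M)) β {gridLegPos X, gridLegPos Y} ≤ αw)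
    (hcol : ∀ Y, ∑ X, ‖((hubbardGridSub L M β (2 * (2 * M))).transpose * hubbardCovAboveCT L M β μ 0 K klE0 *
      hubbardGridSub L M β (2 * (2 * M))) X Y‖ * gridLabelWt L (2 * (2 * M)) β {gridLegPos X, gridLegPos Y} ≤ αw)
    {ρ : ℝ} (hρ : 0 < ρ)
    (hθ : Real.exp 1 * αw * normV (GridLeg (GridPoint L (2 * (2 * M)))) κ ρ
      (fun m' : ℕ => if m' = 1 then |β| / (2 * (2 * M) : ℕ) * ∑ z : TorusSite 2 L, ‖framePosKernel L K z‖ * (1 + torusSiteDist z 0)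
        else if m' = 2 then |U| * |β| / (2 * (2 * M) : ℕ) else 0) / κ ^ 2 < 1)
    {crt cct : ℝ} (hcct0 : 0 ≤ cct)
    (hrow' : ∀ X'' : SpaceTimeIdx L M × SectorLeg 1, ∑ X' : GridLeg (GridPoint L (2 * (2 * M))),
      ‖(sectorAnalysisMatrix L M β (trivialMultiplier L M) * hubbardGridSub L M β (2 * (2 * M))) X'' X'‖ *
        gridLabelWt L (2 * (2 * M)) β {latticeLegPos (2 * (2 * M)) X'', gridLegPos X'} ≤ crt)
    (hcol' : ∀ X' : GridLeg (GridPoint L (2 * (2 * M))), ∑ X'' : SpaceTimeIdx L M × SectorLeg 1,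
      ‖(sectorAnalysisMatrix L M β (trivialMultiplier L M) * hubbardGridSub L M β (2 * (2 * M))) X'' X'‖ *
        gridLabelWt L (2 * (2 * M)) β {latticeLegPos (2 * (2 * M)) X'', gridLegPos X'} ≤ cct)

include hβ hκ hGB hαw hrow hcol hρ hθ hcct0 hrow' hcol'

/-! ## §2 The trivial-family weighted one-pinned sums of `𝒱_0` from ONE grid step (p3 g8's three weighted sizes + the cross sums of `E_t·S`) -/

/-- **Degrees `2p ≥ 4`, trivial family, from ONE decay-weighted bi-graded determinant-bounded grid step** (twin of `klWtPinnedSum_zero_le_of_wgridStep` with the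
trivial analysis `E_t = sectorAnalysisMatrix β (trivialMultiplier L M)` in place of `E₀`): for every `p ≥ 2`, pinned leg `q` and index `w`,
`Σ_{X : X q = w} gridLabelWt(positions X)·‖kernel (map E_t 𝒱_0) (2p) X‖ ≤ cr_t·cc_t^{2p−1}·(ρ^{−2p}·e f₂·(eα_w f₂/κ²)^{p−2}/(1−θ_w)^p)`,
`f₂ = (e²(κ+ρ))⁴·|U||β|/(4M)`. [cite: BenfattoGiulianiMastropietro2006, §2.8 (2.77)-(2.84), §3 (3.2)-(3.8)] -/
theorem uvWtPinnedSum_le_of_wgridStep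
    {p : ℕ} (hp : 2 ≤ p) (q : Fin (2 * p)) (w : SpaceTimeIdx L M × SectorLeg 1) :
    ∑ X ∈ univ.filter (fun X : Fin (2 * p) → SpaceTimeIdx L M × SectorLeg 1 => X q = w),
        gridLabelWt L (2 * (2 * M)) β ((univ.image X).image (latticeLegPos (2 * (2 * M)))) *
          ‖kernel ℂ (ExteriorAlgebra.map (Matrix.toLin' (sectorAnalysisMatrix L M β (trivialMultiplier L M)))
              (klEffectiveAction L M β U μ K klE0 0)) (2 * p) X‖ ≤
      crt * cct ^ (2 * p - 1) *
        (ρ⁻¹ ^ (2 * p) * (Real.exp 1 * ((Real.exp 2 * (κ + ρ)) ^ (2 * 2) * (|U| * |β| / (2 * (2 * M) : ℕ)))) *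
          (Real.exp 1 * αw * ((Real.exp 2 * (κ + ρ)) ^ (2 * 2) * (|U| * |β| / (2 * (2 * M) : ℕ))) / κ ^ 2) ^ (p - 2) /
            (1 - Real.exp 1 * αw * normV (GridLeg (GridPoint L (2 * (2 * M)))) κ ρ
              (fun m' : ℕ => if m' = 1 then |β| / (2 * (2 * M) : ℕ) * ∑ z : TorusSite 2 L, ‖framePosKernel L K z‖ * (1 + torusSiteDist z 0)
                else if m' = 2 then |U| * |β| / (2 * (2 * M) : ℕ) else 0) / κ ^ 2) ^ p) := by
  -- notation
  set Ng : ℕ := 2 * (2 * M) with hNg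
  haveI : NeZero Ng := ⟨by rw [hNg]; have := NeZero.ne M; omega⟩
  set S := hubbardGridSub L M β Ng with hS
  set C₀ := hubbardCovAboveCT L M β μ 0 K klE0 with hC₀
  set Et := sectorAnalysisMatrix L M β (trivialMultiplier L M) with hEt
  set Vt := hubbardGridInteraction L Ng β U + hubbardGridCounterQuadratic L Ng β K with hVt
  set wt := gridLabelWt L Ng β with hwt
  set Nw : ℕ → ℝ := fun m' : ℕ => if m' = 1 then |β| / Ng * ∑ z : TorusSite 2 L, ‖framePosKernel L K z‖ * (1 + torusSiteDist z 0)
    else if m' = 2 then |U| * |β| / Ng else 0 with hNw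
  have hwtree : IsTreeWeight wt := isTreeWeight_gridLabelWt L Ng hβ.le
  have hfS : LinearMap.toMatrix' (Matrix.toLin' S) = S := LinearMap.toMatrix'_toLin' S
  have hgE : LinearMap.toMatrix' (Matrix.toLin' Et) = Et := LinearMap.toMatrix'_toLin' Et
  have hVt_even : Vt ∈ evenPart ℂ (GridLeg (GridPoint L Ng)) :=
    add_mem (hubbardGridInteraction_mem_evenPart β U) (hubbardGridCounterQuadratic_mem_evenPart β K)
  have hVt0 : constPart ℂ Vt = 0 := by
    rw [hVt, map_add, constPart_hubbardGridInteraction, constPart_hubbardGridCounterQuadratic, add_zero]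
  have hNw2 : ∀ m', 2 < m' → Nw m' = 0 := fun m' hm' => by
    rw [hNw]; dsimp only; rw [if_neg (by omega), if_neg (by omega)]
  -- the weighted bi-graded step, output read through `E_t`, degree `2p`, leg `q` pinned at `w`
  have hstep := (sum_wt_norm_kernel_map_effAction_le_biquartic_of_gramBounded hwtree gridLegPos (latticeLegPos Ng) C₀ (Matrix.toLin' S)
    (Matrix.toLin' Et) Vt hVt_even hVt0 Nw (scaleZeroPinnedW_nonneg β U K)
    (fun m' j w => sum_norm_kernel_gridVertex_mul_wt_le β U hβ.le K m' j w) hNw2 hκ (by rw [hfS]; exact hGB) hαw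
    (by rw [hfS]; exact hrow) (by rw [hfS]; exact hcol) hρ hθ hcct0
    (fun X'' => by rw [hfS, hgE]; exact hrow' X'') (fun X' => by rw [hfS, hgE]; exact hcol' X') hp q w).2
  rw [klEffectiveAction_zero_eq_effAction_map hβ.ne' U μ K]
  exact hstep

/-- **Every degree `m ≥ 1`, trivial family, from the FULL decay-weighted determinant-bounded grid step** (twin of `klWtPinnedSum_zero_le_of_wgridStep_full`;
used at `m = 2`, where the kernel of `𝒱_0` contains the counterterm and the tadpole):
`Σ_{X : X q = w} gridLabelWt(positions X)·‖kernel (map E_t 𝒱_0) m X‖ ≤ cr_t·cc_t^{m−1}·(ρ^{−m}·e‖Ṽ‖_{h,wt}/(1−θ_w))`.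
[cite: BenfattoGiulianiMastropietro2006, §2.8 (2.77)-(2.84), §3 (3.2)-(3.8)] -/
theorem uvWtPinnedSum_le_of_wgridStep_full
    {m : ℕ} (hm : 0 < m) (q : Fin m) (w : SpaceTimeIdx L M × SectorLeg 1) :
    ∑ X ∈ univ.filter (fun X : Fin m → SpaceTimeIdx L M × SectorLeg 1 => X q = w),
        gridLabelWt L (2 * (2 * M)) β ((univ.image X).image (latticeLegPos (2 * (2 * M)))) *
          ‖kernel ℂ (ExteriorAlgebra.map (Matrix.toLin' (sectorAnalysisMatrix L M β (trivialMultiplier L M)))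
              (klEffectiveAction L M β U μ K klE0 0)) m X‖ ≤
      crt * cct ^ (m - 1) *
        (ρ⁻¹ ^ m * (Real.exp 1 * normV (GridLeg (GridPoint L (2 * (2 * M)))) κ ρ
            (fun m' : ℕ => if m' = 1 then |β| / (2 * (2 * M) : ℕ) * ∑ z : TorusSite 2 L, ‖framePosKernel L K z‖ * (1 + torusSiteDist z 0)
              else if m' = 2 then |U| * |β| / (2 * (2 * M) : ℕ) else 0)) /
          (1 - Real.exp 1 * αw * normV (GridLeg (GridPoint L (2 * (2 * M)))) κ ρ
            (fun m' : ℕ => if m' = 1 then |β| / (2 * (2 * M) : ℕ) * ∑ z : TorusSite 2 L, ‖framePosKernel L K z‖ * (1 + torusSiteDist z 0)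
              else if m' = 2 then |U| * |β| / (2 * (2 * M) : ℕ) else 0) / κ ^ 2)) := by
  -- notation
  set Ng : ℕ := 2 * (2 * M) with hNg
  haveI : NeZero Ng := ⟨by rw [hNg]; have := NeZero.ne M; omega⟩
  set S := hubbardGridSub L M β Ng with hS
  set C₀ := hubbardCovAboveCT L M β μ 0 K klE0 with hC₀
  set C' := S.transpose * C₀ * S with hC'
  set Et := sectorAnalysisMatrix L M β (trivialMultiplier L M) with hEt
  set Vt := hubbardGridInteraction L Ng β U + hubbardGridCounterQuadratic L Ng β K with hVt
  set wt := gridLabelWt L Ng β with hwt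
  set Nw : ℕ → ℝ := fun m' : ℕ => if m' = 1 then |β| / Ng * ∑ z : TorusSite 2 L, ‖framePosKernel L K z‖ * (1 + torusSiteDist z 0)
    else if m' = 2 then |U| * |β| / Ng else 0 with hNw
  have hwtree : IsTreeWeight wt := isTreeWeight_gridLabelWt L Ng hβ.le
  have hwt' : IsTreeWeight (fun T : Finset (GridLeg (GridPoint L Ng)) => wt (T.image gridLegPos)) := hwtree.comap gridLegPos
  have hpair : ∀ X Y : GridLeg (GridPoint L Ng), (fun T : Finset (GridLeg (GridPoint L Ng)) => wt (T.image gridLegPos)) {X, Y} =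
      wt {gridLegPos X, gridLegPos Y} := fun X Y => by simp only [image_insert, image_singleton]
  have hfS : LinearMap.toMatrix' (Matrix.toLin' S) = S := LinearMap.toMatrix'_toLin' S
  have hgE : LinearMap.toMatrix' (Matrix.toLin' Et) = Et := LinearMap.toMatrix'_toLin' Et
  have hVt_even : Vt ∈ evenPart ℂ (GridLeg (GridPoint L Ng)) :=
    add_mem (hubbardGridInteraction_mem_evenPart β U) (hubbardGridCounterQuadratic_mem_evenPart β K)
  have hVt0 : constPart ℂ Vt = 0 := by
    rw [hVt, map_add, constPart_hubbardGridInteraction, constPart_hubbardGridCounterQuadratic, add_zero]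
  -- (1) the full weighted step on the grid with covariance `C' = SᵀC₀S`
  obtain ⟨-, hfull⟩ := sum_wt_norm_kernel_effAction_le_of_gramBounded C' hwt' hκ hGB Vt hVt_even hVt0 Nw (scaleZeroPinnedW_nonneg β U K)
    (fun m' j w => sum_norm_kernel_gridVertex_mul_wt_le β U hβ.le K m' j w) hαw
    (fun X => by simp only [hpair]; exact hrow X) (fun Y => by simp only [hpair]; exact hcol Y) hρ hθ
  have hθle : 0 ≤ 1 - Real.exp 1 * αw * normV (GridLeg (GridPoint L Ng)) κ ρ Nw / κ ^ 2 := sub_nonneg.2 hθ.le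
  have hB0 : 0 ≤ ρ⁻¹ ^ m * (Real.exp 1 * normV (GridLeg (GridPoint L Ng)) κ ρ Nw) /
      (1 - Real.exp 1 * αw * normV (GridLeg (GridPoint L Ng)) κ ρ Nw / κ ^ 2) :=
    div_nonneg (mul_nonneg (pow_nonneg (inv_nonneg.2 hρ.le) _)
      (mul_nonneg (Real.exp_pos 1).le (normV_nonneg hκ.le hρ.le (scaleZeroPinnedW_nonneg β U K)))) hθle
  have hfull' : ∀ (q' : Fin m) (x : GridLeg (GridPoint L Ng)),
      ∑ X ∈ univ.filter (fun X : Fin m → GridLeg (GridPoint L Ng) => X q' = x),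
        ‖kernel ℂ (effAction ℂ C' Vt) m X‖ * wt ((univ.image X).image gridLegPos) ≤
          ρ⁻¹ ^ m * (Real.exp 1 * normV (GridLeg (GridPoint L Ng)) κ ρ Nw) /
            (1 - Real.exp 1 * αw * normV (GridLeg (GridPoint L Ng)) κ ρ Nw / κ ^ 2) := by
    intro q' x
    exact (le_of_eq (sum_congr rfl fun X _ => mul_comm _ _)).trans (hfull hm q' x)
  -- (2) read through `E_t·S` by the weighted Young step
  have hyoung := sum_filter_wt_norm_kernel_map_le_of_pos hwtree gridLegPos (latticeLegPos Ng)
    ((Matrix.toLin' Et) ∘ₗ (Matrix.toLin' S)) hcct0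
    (by intro X''; rw [LinearMap.toMatrix'_comp, hfS, hgE]; exact hrow' X'')
    (by intro X'; rw [LinearMap.toMatrix'_comp, hfS, hgE]; exact hcol' X') (effAction ℂ C' Vt) hm hB0 hfull' q w
  -- (3) the analysed scale-`0` action is `map (E_t ∘ S) (effAction C' Ṽ)`
  rw [klEffectiveAction_zero_eq_effAction_map hβ.ne' U μ K]
  have hrepr : ExteriorAlgebra.map (Matrix.toLin' Et) (effAction ℂ C₀ (ExteriorAlgebra.map (Matrix.toLin' S) Vt)) =
      ExteriorAlgebra.map ((Matrix.toLin' Et) ∘ₗ (Matrix.toLin' S)) (effAction ℂ C' Vt) := by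
    rw [effAction_map, hfS, map_map_eq_map_comp]
  rw [hrepr]
  exact hyoung


/-! ## §3 The UV carriers from the grid step -/

/-- **`klTowerUVWt … (2p)` from the grid step** (degrees `2p ≥ 4`, bi-graded). [cite: BenfattoGiulianiMastropietro2006, §2.8 (2.77)-(2.84), §3 (3.2)-(3.8)] -/
theorem klTowerUVWt_le_of_wgridStep (hcrt0 : 0 ≤ crt) {p : ℕ} (hp : 2 ≤ p) :
    klTowerUVWt L M β U μ K (2 * p) ≤
      imagTimeWeight β M ^ (2 * p - 1) * (crt * cct ^ (2 * p - 1) *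
        (ρ⁻¹ ^ (2 * p) * (Real.exp 1 * ((Real.exp 2 * (κ + ρ)) ^ (2 * 2) * (|U| * |β| / (2 * (2 * M) : ℕ)))) *
          (Real.exp 1 * αw * ((Real.exp 2 * (κ + ρ)) ^ (2 * 2) * (|U| * |β| / (2 * (2 * M) : ℕ))) / κ ^ 2) ^ (p - 2) /
            (1 - Real.exp 1 * αw * normV (GridLeg (GridPoint L (2 * (2 * M)))) κ ρ
              (fun m' : ℕ => if m' = 1 then |β| / (2 * (2 * M) : ℕ) * ∑ z : TorusSite 2 L, ‖framePosKernel L K z‖ * (1 + torusSiteDist z 0)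
                else if m' = 2 then |U| * |β| / (2 * (2 * M) : ℕ) else 0) / κ ^ 2) ^ p)) := by
  refine klTowerUVWt_le_of_pinned hβ.le U μ K ?_ fun q w =>
    uvWtPinnedSum_le_of_wgridStep hβ U μ K hκ hGB hαw hrow hcol hρ hθ hcct0 hrow' hcol' hp q w
  exact mul_nonneg (mul_nonneg hcrt0 (pow_nonneg hcct0 _)) (div_nonneg (by positivity) (pow_nonneg (sub_nonneg.2 hθ.le) _))

/-- **`klTowerUVLev … (2p)` from the grid step** (degrees `2p ≥ 4`, bi-graded): the block-`0` datum of the levelled law in every degree `≥ 4`.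
[cite: BenfattoGiulianiMastropietro2006, §2.8 (2.77)-(2.84), §3 (3.2)-(3.8)] -/
theorem klTowerUVLev_le_of_wgridStep (hcrt0 : 0 ≤ crt) {p : ℕ} (hp : 2 ≤ p) :
    klTowerUVLev L M β U μ K (2 * p) ≤
      imagTimeWeight β M ^ (2 * p - 1) * (crt * cct ^ (2 * p - 1) *
        (ρ⁻¹ ^ (2 * p) * (Real.exp 1 * ((Real.exp 2 * (κ + ρ)) ^ (2 * 2) * (|U| * |β| / (2 * (2 * M) : ℕ)))) *
          (Real.exp 1 * αw * ((Real.exp 2 * (κ + ρ)) ^ (2 * 2) * (|U| * |β| / (2 * (2 * M) : ℕ))) / κ ^ 2) ^ (p - 2) /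
            (1 - Real.exp 1 * αw * normV (GridLeg (GridPoint L (2 * (2 * M)))) κ ρ
              (fun m' : ℕ => if m' = 1 then |β| / (2 * (2 * M) : ℕ) * ∑ z : TorusSite 2 L, ‖framePosKernel L K z‖ * (1 + torusSiteDist z 0)
                else if m' = 2 then |U| * |β| / (2 * (2 * M) : ℕ) else 0) / κ ^ 2) ^ p)) := by
  refine klTowerUVLev_le_of_pinned hβ.le U μ K (by omega) ?_ fun q w =>
    uvWtPinnedSum_le_of_wgridStep hβ U μ K hκ hGB hαw hrow hcol hρ hθ hcct0 hrow' hcol' hp q w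
  exact mul_nonneg (mul_nonneg hcrt0 (pow_nonneg hcct0 _)) (div_nonneg (by positivity) (pow_nonneg (sub_nonneg.2 hθ.le) _))

/-- **`klTowerUVLev … m` from the FULL grid step** (every degree `m ≥ 1`; at `m = 2` the law's `μ0 1`).
[cite: BenfattoGiulianiMastropietro2006, §2.8 (2.77)-(2.84), §3 (3.2)-(3.8)] -/
theorem klTowerUVLev_le_of_wgridStep_full (hcrt0 : 0 ≤ crt) {m : ℕ} (hm : 1 ≤ m) :
    klTowerUVLev L M β U μ K m ≤
      imagTimeWeight β M ^ (m - 1) * (crt * cct ^ (m - 1) *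
        (ρ⁻¹ ^ m * (Real.exp 1 * normV (GridLeg (GridPoint L (2 * (2 * M)))) κ ρ
            (fun m' : ℕ => if m' = 1 then |β| / (2 * (2 * M) : ℕ) * ∑ z : TorusSite 2 L, ‖framePosKernel L K z‖ * (1 + torusSiteDist z 0)
              else if m' = 2 then |U| * |β| / (2 * (2 * M) : ℕ) else 0)) /
          (1 - Real.exp 1 * αw * normV (GridLeg (GridPoint L (2 * (2 * M)))) κ ρ
            (fun m' : ℕ => if m' = 1 then |β| / (2 * (2 * M) : ℕ) * ∑ z : TorusSite 2 L, ‖framePosKernel L K z‖ * (1 + torusSiteDist z 0)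
              else if m' = 2 then |U| * |β| / (2 * (2 * M) : ℕ) else 0) / κ ^ 2))) := by
  haveI : NeZero (2 * (2 * M)) := ⟨by have := NeZero.ne M; omega⟩
  refine klTowerUVLev_le_of_pinned hβ.le U μ K hm ?_ fun q w =>
    uvWtPinnedSum_le_of_wgridStep_full hβ U μ K hκ hGB hαw hrow hcol hρ hθ hcct0 hrow' hcol' (by omega) q w
  exact mul_nonneg (mul_nonneg hcrt0 (pow_nonneg hcct0 _)) (div_nonneg (mul_nonneg (pow_nonneg (inv_nonneg.2 hρ.le) _)
    (mul_nonneg (Real.exp_pos 1).le (normV_nonneg hκ.le hρ.le (scaleZeroPinnedW_nonneg β U K)))) (sub_nonneg.2 hθ.le))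

end GridStep

/-! ## §4 The law's block-`0` array in profile form -/

/-- The bi-graded bracket as a geometric profile: for `p ≥ 2`, `cc ≠ 0`, `G ≠ 0`,
`cr·cc^{2p−1}·(ρ⁻¹^{2p}·F·G^{p−2}/D^p) = (cr·F/(cc·G²))·(cc²·ρ⁻¹²·G/D)^p`. [folklore] -/
theorem uvBracket_eq_profile {cr cc ρi F G D : ℝ} (hcc : cc ≠ 0) (hG : G ≠ 0) {p : ℕ} (hp : 2 ≤ p) :
    cr * cc ^ (2 * p - 1) * (ρi ^ (2 * p) * F * G ^ (p - 2) / D ^ p) = cr * F / (cc * G ^ 2) * (cc ^ 2 * ρi ^ 2 * G / D) ^ p := by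
  obtain ⟨n, rfl⟩ : ∃ n, p = n + 2 := ⟨p - 2, by omega⟩
  rw [show 2 * (n + 2) - 1 = 2 * n + 3 by omega, Nat.add_sub_cancel, div_pow, mul_pow, mul_pow, ← pow_mul, ← pow_mul]
  field_simp
  ring

/-- **THE LAW's BLOCK-`0` ARRAY IN PROFILE FORM**: if `klTowerUVLev … (2m) ≤ ε^{2m−1}·cr·cc^{2m−1}·(ρ⁻¹^{2m}·F·G^{m−2}/D^m)` for `m ≥ 2` (§3, with
`F = e·f₂`, `G = eα_w f₂/κ²`, `D = 1 − θ_w`), then for every `λ > 0`, `W₀, Z₀ ≥ 0` and `m ≥ 2` the array `μ0 m = W₀·Z₀^m·(klTowerUVLev … (2m)/ε^{2m−1})` obeys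
`μ0 m ≤ A′·λ^{m−1}·Q′^m` with `A′ = W₀·(cr·F/(cc·G²))·λ`, `Q′ = Z₀·(cc²ρ⁻¹²G/D)/λ` — the `hμ0prof` / `hμ03` / `hι₂ (k = 0)` shape of
`klTowerBLev_le_law_of_inputs_uv` (`cc, G > 0`, `β > 0`). [cite: BenfattoGiulianiMastropietro2006, §2.8 (2.83), (2.93)-(2.98)] -/
theorem towerUVArray_le_profile [NeZero M] {β : ℝ} (hβ : 0 < β) (U μ : ℝ) (K : TrigPolyC4v) {cr cc ρi F G D : ℝ}
    (hcc : 0 < cc) (hG : 0 < G)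
    (h : ∀ m, 2 ≤ m → klTowerUVLev L M β U μ K (2 * m) ≤ imagTimeWeight β M ^ (2 * m - 1) * (cr * cc ^ (2 * m - 1) * (ρi ^ (2 * m) * F * G ^ (m - 2) / D ^ m)))
    {W₀ Z₀ lam : ℝ} (hW₀ : 0 ≤ W₀) (hZ₀ : 0 ≤ Z₀) (hlam : 0 < lam) {m : ℕ} (hm : 2 ≤ m) :
    W₀ * Z₀ ^ m * (klTowerUVLev L M β U μ K (2 * m) / imagTimeWeight β M ^ (2 * m - 1)) ≤
      (W₀ * (cr * F / (cc * G ^ 2)) * lam) * lam ^ (m - 1) * (Z₀ * (cc ^ 2 * ρi ^ 2 * G / D) / lam) ^ m := by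
  have hx : 0 < imagTimeWeight β M := by
    unfold imagTimeWeight
    have : (0 : ℝ) < M := Nat.cast_pos.2 (Nat.pos_of_ne_zero (NeZero.ne M))
    positivity
  have hq : klTowerUVLev L M β U μ K (2 * m) / imagTimeWeight β M ^ (2 * m - 1) ≤ cr * F / (cc * G ^ 2) * (cc ^ 2 * ρi ^ 2 * G / D) ^ m := by
    rw [div_le_iff₀ (pow_pos hx _), ← uvBracket_eq_profile hcc.ne' hG.ne' hm]
    exact (h m hm).trans_eq (mul_comm _ _)
  have hlam0 : lam ≠ 0 := hlam.ne'
  obtain ⟨n, rfl⟩ : ∃ n, m = n + 1 := ⟨m - 1, by omega⟩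
  calc W₀ * Z₀ ^ (n + 1) * (klTowerUVLev L M β U μ K (2 * (n + 1)) / imagTimeWeight β M ^ (2 * (n + 1) - 1))
      ≤ W₀ * Z₀ ^ (n + 1) * (cr * F / (cc * G ^ 2) * (cc ^ 2 * ρi ^ 2 * G / D) ^ (n + 1)) :=
        mul_le_mul_of_nonneg_left hq (by positivity)
    _ = (W₀ * (cr * F / (cc * G ^ 2)) * lam) * lam ^ (n + 1 - 1) * (Z₀ * (cc ^ 2 * ρi ^ 2 * G / D) / lam) ^ (n + 1) := by
        rw [Nat.add_sub_cancel, div_pow _ lam, mul_pow Z₀]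
        have hl : lam * lam ^ n / lam ^ (n + 1) = 1 := by rw [← pow_succ', div_self (pow_ne_zero _ hlam0)]
        calc W₀ * Z₀ ^ (n + 1) * (cr * F / (cc * G ^ 2) * (cc ^ 2 * ρi ^ 2 * G / D) ^ (n + 1))
            = W₀ * (cr * F / (cc * G ^ 2)) * (Z₀ ^ (n + 1) * (cc ^ 2 * ρi ^ 2 * G / D) ^ (n + 1)) * (lam * lam ^ n / lam ^ (n + 1)) := by
              rw [hl, mul_one]; ring
          _ = _ := by ring

end Summit.HubbardSuperconductivity.HubbardSuperconductivity.Theorems.EngineV8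

end
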